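import Summits.BirchSwinnertonDyer.Rank1Residual.Partition.YanZhuImForm
import Summits.BirchSwinnertonDyer.BirchSwinnertonDyer.Theorems.ToricSheddingUBPotentiallyGoodStubTwistAdmissible
import Literature.NumberTheory.EllipticCurves.ExceptionalPrimesDensityModels
import HarnessLib

/-!
# `p`-adic surjectivity is invariant under quadratic twist; on row C16 (= scoreboard row D3)
# every quadratic twist `E^K` has `ρ_{E^K,3}` onto `GL₂(ℤ₃)` and satisfies Yan–Zhu's (Im)
# (cell `bsd-litref`, paper sub-dir `yz26`, seat `bsd-litref-yz26-pv`; LADDER-BSD H1 / W7, row D3)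

HONEST FRAMING (programme `BSD-LIT2PART-PROGRAMME-v1.md` §HONESTY, verbatim): «no tranche here
proves BSD; ARM L moves the LITERAL column of an r ≤ 1 census into the
kernel-proved-modulo-named-print column; ARM P changes what «named print» is worth.» Theorems
only; no named fact is introduced (Wuthrich 2014 Lemma 20 enters, as on row C16 itself, as the
tree's existing named fact, by hypothesis).

## Why (the proof-internal hypothesis this file discharges on D3)

Yan–Zhu, J. Algebra 693 (2026) = arXiv:2412.20078v4, prove the cyclotomic main conjecture for `E`
(Thm. 5.2 = v2 Thm. 4.9) by descending the two-variable main conjecture over an imaginary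
quadratic field `K` to the cyclotomic line, where it splits as MC(`E/ℚ_∞`) × MC(`E^K/ℚ_∞`), and
then invoking Kato's divisibility [Kato, Thm. 17.14] for `E` AND FOR THE TWIST `E^K`, "in `Λ_ℚ`
under the condition (Im)" (v4 proof of Thm. 5.2, l.1146–1148); Cor. 5.4 (the `r = 1` leg of
Thm. 5.11 = v2 Thm. 4.15, row D3's binder `YanZhu2026.thm415_padicValRat_bsd_rank_le_one[_of_bigIm]`)
is "Theorem 5.2 (applied to `E` and `E^K`)" (l.1183). The printed statements carry (Im) for `E`
only. So "(Im) for `E^K`" is a hypothesis-AS-USED of the proof that is not a hypothesis of the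
statement — exactly the kind of line a D-audit sheet prices. This file shows, in the kernel, that
on row C16 / D3 (`p = 3`, good ordinary, `E[3]` irreducible, surj(3) ∨ ram(3)) it holds for EVERY
quadratic twist, in the strongest form:

* `hasSurjectiveModNGaloisRep_pow_of_addEquiv_signed`, `towerSurj_quadraticTwist_iff`,
  `towerSurj_iff_of_model_twist` — **for every prime `p` and every `d ∈ ℚ^×`, `ρ_{E^{(d)},p}` is
  onto `GL₂(ℤ_p)` iff `ρ_{E,p}` is** (all `ρ̄_{·,p^n}` onto). Mechanism (Serre 1972 §4, as in the
  tree's mod-`p` version `twistAdmissible_hasSurjectiveModNGaloisRep_of_addEquiv_signed`): along the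
  `χ_d`-equivariant isomorphism `E^{(d)}(ℚ̄) ≃+ E(ℚ̄)` the two images in `Aut(E[p^n])` agree up to
  the central sign, every square of the full group lies in the twisted image, and `-1 = J²` for the
  quarter turn `J = (0 -1; 1 0)` written in a `ℤ/p^n`-frame of `E[p^n]`
  (`exists_addAut_torsion_primePow_sq_eq_neg`, from the tree's Tate-module level maps,
  `TateModule.levelMap_bijective`).
* `bigIm_of_model_twist_of_towerSurj` — hence `p`-adic surjectivity of `E` gives (Im) (`BigIm`) for
  every `ℚ`-model of every quadratic twist (`X9.bigIm_of_hasSurjectiveModNGaloisRep_pow`).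
* `RowC16.towerSurj_twist`, `RowC16.bigIm_twist` — **on row C16 / D3, granted Wuthrich 2014 Lemma 20,
  every quadratic twist `E^{(d)}` (any model, any `d ≠ 0`, in particular `E^K` for every imaginary
  quadratic `K` of the proof) has `ρ_{E^{(d)},3}` onto `GL₂(ℤ₃)` and satisfies (Im) at `3`.** So the
  proof-internal hypothesis "(Im) for `E^K`" costs 0 of the row's 4 814 classes, whichever `K`
  Yan–Zhu's proof chooses ([FH]/[BFH] supply infinitely many).

Not done here (general form): at an odd prime, (Im) for `E` alone already gives (Im) for every
`E^{(d)}` (if `τ ∈ G_{ℚ(μ_{p^∞})}` is an (Im)-witness then `det ρ_E(τ) = χ(τ) = 1` makes `ρ_E(τ)`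
unipotent, and `τ²`, on which `χ_d` is trivial, is a witness for both curves since `2 ∈ ℤ_p^×`).
-- TODO(general form): `p ≠ 2 → BigIm W p → BigIm (C • W.quadraticTwist d) p`.

References: X. Yan, X. Zhu, J. Algebra 693 (2026) 372–402 = arXiv:2412.20078v4, proof of Thm. 5.2
(l.1140–1160), Cor. 5.4 (l.1166–1184), (Im) (l.349–351); K. Kato, Astérisque 295 (2004) Thm. 17.4;
J.-P. Serre, Invent. Math. 15 (1972) §4; J. H. Silverman, *AEC* X.5 Cor. 5.4, III.6.4, III.§7;
C. Wuthrich, Doc. Math. 19 (2014) Lemma 20; tree `X9/SurjBigImage.lean`, `X9/GaloisShear.lean`,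
`Additive/QuadraticTwistSurj.lean`, `Partition/YanZhuImForm.lean`.
-/

set_option autoImplicit false

noncomputable section

open scoped Classical

open WeierstrassCurve Field Literature.NumberTheory.EllipticCurves
  Literature.NumberTheory.EllipticCurves.Rank1Residual
  Summit.BirchSwinnertonDyer.BirchSwinnertonDyer.Theorems

namespace Summit.BirchSwinnertonDyer.Rank1Residual

/-! ### §1 `-1` is a square in `Aut(E[p^k])` -/

/-- The quarter turn `J = (0 -1; 1 0)` of `(ℤ/m)²`: an additive automorphism with `J ∘ J = -1`.
[folklore] -/
theorem exists_quarterTurn_prod_zmod (m : ℕ) :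
    ∃ J : (ZMod m × ZMod m) ≃+ (ZMod m × ZMod m), ∀ v, J (J v) = -v :=
  ⟨{ toFun := fun v ↦ (-v.2, v.1)
     invFun := fun v ↦ (v.2, -v.1)
     left_inv := fun v ↦ by simp
     right_inv := fun v ↦ by simp
     map_add' := fun v w ↦ by
       simp only [Prod.snd_add, Prod.fst_add, neg_add, Prod.mk_add_mk] },
    fun v ↦ Prod.ext (by simp) (by simp)⟩

section Curve

variable (W : WeierstrassCurve ℚ) [W.IsElliptic] (p : ℕ) [Fact p.Prime]

/-- **`-1` is a square in `Aut(E[p^k])`, every `k`.** For an elliptic curve `W/ℚ` and a prime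
power `p^k` there is an additive automorphism `g` of `E[p^k] = E(ℚ̄)[p^k]` with `g ∘ g = -1`: a
`ℤ_p`-basis `a, b` of `T_pE` (tree: `#E[p^k] = p^{2k}`, `card_torsionPoints_eq_sq_holds`;
`TateModule.exists_generators_of_card_torsionBy`, `exists_proj_one_eq`, `levelMap_bijective`)
gives the frame `(x, y) ↦ x a_k + y b_k : (ℤ/p^k)² ≃ E[p^k]`, additive by
`X9.val_smul_frame_add`; transport the quarter turn `(0 -1; 1 0)` along it.
[cite: SilvermanAEC2009, Cor. III.6.4(b)] -/
theorem exists_addAut_torsion_primePow_sq_eq_neg (k : ℕ) :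
    ∃ g : geomTorsion W ((p ^ k : ℕ) : ℤ) ≃+ geomTorsion W ((p ^ k : ℕ) : ℤ),
      ∀ P, g (g P) = -P := by
  have hp : p.Prime := Fact.out
  have hpQ : (p : ℚ) ≠ 0 := Nat.cast_ne_zero.mpr hp.ne_zero
  -- torsion counts `#E[p^k] = p^{2k}` and a `ℤ_p`-basis `a, b` of `T_p E`
  have hc : ∀ k : ℕ, Nat.card (geomTorsion W ((p ^ k : ℕ) : ℤ)) = p ^ (2 * k) :=
    card_geomTorsion_pow_eq W p (card_torsionPoints_eq_sq_holds W (AlgebraicClosure ℚ)) hpQ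
  obtain ⟨P₁, hP₁, Q₁, hQ₁, hgen₁⟩ :=
    TateModule.exists_generators_of_card_torsionBy (A := geomPoints W) (p := p) (by simpa using hc 1)
  have hs := TateModule.exists_smul_eq_of_card_torsionBy (A := geomPoints W) hc
  obtain ⟨a, ha⟩ := TateModule.exists_proj_one_eq (A := geomPoints W) (fun k P hP ↦ hs k hP) hP₁
  obtain ⟨b, hb⟩ := TateModule.exists_proj_one_eq (A := geomPoints W) (fun k P hP ↦ hs k hP) hQ₁
  have hgen : ∀ R ∈ geomTorsion W ((p : ℕ) : ℤ), ∃ m n : ℤ,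
      m • TateModule.proj p 1 a + n • TateModule.proj p 1 b = R := by
    rw [ha, hb]; exact hgen₁
  have hlev : Function.Bijective (TateModule.levelMap p a b k) :=
    TateModule.levelMap_bijective a b hc hgen k
  -- the frame as an additive isomorphism `(ℤ/p^k)² ≃+ E[p^k]`
  haveI : NeZero (p ^ k) := ⟨pow_ne_zero _ hp.ne_zero⟩
  have hLadd : ∀ x y, TateModule.levelMap p a b k (x + y) =
      TateModule.levelMap p a b k x + TateModule.levelMap p a b k y := fun x y ↦ by
    apply Subtype.ext
    rw [AddSubgroup.coe_add, TateModule.coe_levelMap, TateModule.coe_levelMap,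
      TateModule.coe_levelMap]
    exact X9.val_smul_frame_add W (TateModule.proj_mem_torsionBy k a)
      (TateModule.proj_mem_torsionBy k b) x y
  let Le : (ZMod (p ^ k) × ZMod (p ^ k)) ≃+ geomTorsion W ((p ^ k : ℕ) : ℤ) :=
    AddEquiv.ofBijective (AddMonoidHom.mk' (TateModule.levelMap p a b k) hLadd) hlev
  obtain ⟨J, hJ⟩ := exists_quarterTurn_prod_zmod (p ^ k)
  refine ⟨(Le.symm.trans J).trans Le, fun P ↦ ?_⟩
  simp only [AddEquiv.trans_apply, AddEquiv.symm_apply_apply, hJ, map_neg, AddEquiv.apply_symm_apply]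

/-! ### §2 `p`-adic surjectivity through a sign-twisted isomorphism of curves -/

/-- **Surjectivity of `ρ̄_{E,p^k}` is invariant under twisting by a quadratic character.** If
`f : E₁(ℚ̄) ≃+ E₂(ℚ̄)` is additive and, for every `σ ∈ Γ_ℚ`, equivariant or anti-equivariant at
`σ` (`f(σP) = ±σ f(P)`), then `ρ̄_{E₂,p^k}` onto `Aut(E₂[p^k])` implies `ρ̄_{E₁,p^k}` onto
(`E₂` elliptic): restrict `f` to `E₁[p^k] ≃+ E₂[p^k]` (`torsionByEquiv`) and apply the tree's
`twistAdmissible_surjective_toAddAut_of_signEquivariant` with `-1 = g²` in `Aut(E₂[p^k])`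
(`exists_addAut_torsion_primePow_sq_eq_neg`): the two images agree up to the central sign, every
square lies in the image of `E₁`, so `-1` does, so everything does. The level-`p` case is the
tree's `twistAdmissible_hasSurjectiveModNGaloisRep_of_addEquiv_signed`. [cite: Serre1972, §4] -/
theorem hasSurjectiveModNGaloisRep_pow_of_addEquiv_signed
    {W₁ W₂ : WeierstrassCurve ℚ} [W₂.IsElliptic] (f : geomPoints W₁ ≃+ geomPoints W₂)
    (hf : ∀ σ : absoluteGaloisGroup ℚ,
      (∀ P, f (σ • P) = σ • f P) ∨ (∀ P, f (σ • P) = -(σ • f P)))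
    (k : ℕ) (h : W₂.HasSurjectiveModNGaloisRep (p ^ k : ℕ)) :
    W₁.HasSurjectiveModNGaloisRep (p ^ k : ℕ) := by
  obtain ⟨g, hg⟩ := exists_addAut_torsion_primePow_sq_eq_neg W₂ p k
  let e : geomTorsion W₁ ((p ^ k : ℕ) : ℤ) ≃+ geomTorsion W₂ ((p ^ k : ℕ) : ℤ) :=
    torsionByEquiv f (p ^ k)
  have he : ∀ P : geomTorsion W₁ ((p ^ k : ℕ) : ℤ),
      ((e P : geomTorsion W₂ ((p ^ k : ℕ) : ℤ)) : geomPoints W₂) = f P := fun _ ↦ rfl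
  refine twistAdmissible_surjective_toAddAut_of_signEquivariant e (fun σ ↦ ?_) g hg h
  rcases hf σ with hs | hs
  · left
    intro P
    apply Subtype.ext
    rw [he, AddSubgroup.torsionBy.coe_smul, hs, AddSubgroup.torsionBy.coe_smul, he]
  · right
    intro P
    apply Subtype.ext
    rw [he, AddSubgroup.torsionBy.coe_smul, hs, AddSubgroup.coe_neg,
      AddSubgroup.torsionBy.coe_smul, he]

/-- **`ρ_{E^{(d)},p}` onto `GL₂(ℤ_p)` iff `ρ_{E,p}` onto `GL₂(ℤ_p)`**, for every prime `p` and
`d ∈ ℚ^×` (all `ρ̄_{·,p^n}` onto): the twisting isomorphism `E^{(d)}(ℚ̄) ≃+ E(ℚ̄)` is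
`χ_d`-equivariant (`exists_addEquiv_geomPoints_quadraticTwist_signed`, Silverman *AEC* X.5
Cor. 5.4: `E^{(d)}[p^n] ≅ E[p^n] ⊗ χ_d`), so is its inverse, and
`hasSurjectiveModNGaloisRep_pow_of_addEquiv_signed` applies in both directions.
[cite: SilvermanAEC2009, X.5 Cor. 5.4 and X.2 Prop. 2.4] -/
theorem towerSurj_quadraticTwist_iff {d : ℚ} (hd : d ≠ 0) :
    haveI := W.isElliptic_quadraticTwist hd
    (∀ n : ℕ, (W.quadraticTwist d).HasSurjectiveModNGaloisRep (p ^ n : ℕ)) ↔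
      ∀ n : ℕ, W.HasSurjectiveModNGaloisRep (p ^ n : ℕ) := by
  haveI := W.isElliptic_quadraticTwist hd
  haveI : NeZero (2 : ℚ) := ⟨two_ne_zero⟩
  obtain ⟨f, hf⟩ := W.exists_addEquiv_geomPoints_quadraticTwist_signed hd
  have hf' : ∀ σ : absoluteGaloisGroup ℚ,
      (∀ Q, f.symm (σ • Q) = σ • f.symm Q) ∨ (∀ Q, f.symm (σ • Q) = -(σ • f.symm Q)) := by
    intro σ
    rcases hf σ with h | h
    · left
      intro Q
      apply f.injective
      rw [AddEquiv.apply_symm_apply, h, AddEquiv.apply_symm_apply]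
    · right
      intro Q
      apply f.injective
      rw [AddEquiv.apply_symm_apply, map_neg, h, AddEquiv.apply_symm_apply, neg_neg]
  exact ⟨fun h n ↦ hasSurjectiveModNGaloisRep_pow_of_addEquiv_signed p f.symm hf' n (h n),
    fun h n ↦ hasSurjectiveModNGaloisRep_pow_of_addEquiv_signed p f hf n (h n)⟩

/-- **`p`-adic surjectivity for any `ℚ`-model of the twist**: if `C • E^{(d)} = Wd` over `ℚ`
(e.g. `Wd` a globally minimal model of `E^{(d)}`), then `ρ_{Wd,p}` is onto `GL₂(ℤ_p)` iff
`ρ_{E,p}` is (model-independence: tree `hasSurjectiveModNGaloisRep_smul_iff`).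
[cite: SilvermanAEC2009, X.5 Cor. 5.4] -/
theorem towerSurj_iff_of_model_twist {d : ℚ} (hd : d ≠ 0) {Wd : WeierstrassCurve ℚ}
    (hWd : ∃ C : VariableChange ℚ, C • W.quadraticTwist d = Wd) :
    (∀ n : ℕ, Wd.HasSurjectiveModNGaloisRep (p ^ n : ℕ)) ↔
      ∀ n : ℕ, W.HasSurjectiveModNGaloisRep (p ^ n : ℕ) := by
  obtain ⟨C, rfl⟩ := hWd
  rw [← towerSurj_quadraticTwist_iff W p hd]
  exact forall_congr' fun n ↦ hasSurjectiveModNGaloisRep_smul_iff _ C _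

/-- **`p`-adic surjectivity of `E` gives (Im) for every quadratic twist** (any `ℚ`-model `Wd`
of `E^{(d)}`, `d ≠ 0`): `towerSurj_iff_of_model_twist`, then the tree's
`X9.bigIm_of_hasSurjectiveModNGaloisRep_pow` (compactness of `Γ_ℚ` + Weil pairing: some
`τ ∈ G_{ℚ(μ_{p^∞})}` acts as the shear `(1 1; 0 1)` on `T_p E^{(d)}`). [folklore] -/
theorem bigIm_of_model_twist_of_towerSurj {d : ℚ} (hd : d ≠ 0) {Wd : WeierstrassCurve ℚ}
    [Wd.IsElliptic] (hWd : ∃ C : VariableChange ℚ, C • W.quadraticTwist d = Wd)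
    (h : ∀ n : ℕ, W.HasSurjectiveModNGaloisRep (p ^ n : ℕ)) : BigIm Wd p :=
  X9.bigIm_of_hasSurjectiveModNGaloisRep_pow Wd p ((towerSurj_iff_of_model_twist W p hd hWd).mpr h)

end Curve

/-! ### §3 Row C16 (scoreboard row D3): every quadratic twist has full `3`-adic image and (Im) -/

section RowC16

variable {W : WeierstrassCurve ℚ} [W.IsElliptic] [W.IsGloballyMinimal] {p : ℕ} [Fact p.Prime]

/-- **Row C16 ⟹ `ρ_{E^{(d)},3}` onto `GL₂(ℤ₃)` for EVERY quadratic twist** (any `d ≠ 0`, any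
`ℚ`-model `Wd` of `E^{(d)}`), granted Wuthrich 2014 Lemma 20 (`hW20`): the row gives `ρ_{E,3}`
onto `GL₂(ℤ₃)` (`RowC16.threeAdicSurjective`) and `3`-adic surjectivity is twist-invariant
(`towerSurj_iff_of_model_twist`). In particular the twist `E^K` by any imaginary quadratic `K`
in Yan–Zhu's proof of Thm. 5.2 / Cor. 5.4 meets "`Im(ρ) ⊃ SL₂(ℤ₃)`" and Kato 17.4's full-image
hypothesis. [cite: Wuthrich2014, Lemma 20 (p. 399)] -/
theorem RowC16.towerSurj_twist (hW20 : Wuthrich2014.lemma20_surjective_threeAdic_of_semistable)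
    (h : RowC16 W p) {d : ℚ} (hd : d ≠ 0) {Wd : WeierstrassCurve ℚ}
    (hWd : ∃ C : VariableChange ℚ, C • W.quadraticTwist d = Wd) :
    ∀ n : ℕ, Wd.HasSurjectiveModNGaloisRep (3 ^ n : ℕ) := by
  have h3 := RowC16.threeAdicSurjective hW20 h
  obtain ⟨rfl, -, -, -⟩ := h
  exact (towerSurj_iff_of_model_twist W 3 hd hWd).mpr h3

/-- **Row C16 ⟹ (Im) at `3` for EVERY quadratic twist** (`BigIm Wd 3` for any `ℚ`-model `Wd` of
`E^{(d)}`, `d ≠ 0`), granted Wuthrich 2014 Lemma 20: the proof-internal hypothesis "(Im) for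
`E^K`" of Yan–Zhu's Thm. 5.2 (Kato 17.14 for `E^K` "in `Λ_ℚ` under (Im)", v4 l.1146–1148) and
Cor. 5.4 ("Theorem 5.2 applied to `E` and `E^K`", l.1183) holds on every class of row C16 / D3
for every `K`. [cite: YanZhu2024MainConjNonCM, proof of Thm. 4.9 (= v4 Thm. 5.2) and Cor. 5.4, hypothesis (Im) for the twist] -/
theorem RowC16.bigIm_twist (hW20 : Wuthrich2014.lemma20_surjective_threeAdic_of_semistable)
    (h : RowC16 W p) {d : ℚ} (hd : d ≠ 0) {Wd : WeierstrassCurve ℚ} [Wd.IsElliptic]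
    (hWd : ∃ C : VariableChange ℚ, C • W.quadraticTwist d = Wd) : BigIm Wd 3 :=
  X9.bigIm_of_hasSurjectiveModNGaloisRep_pow Wd 3 (RowC16.towerSurj_twist hW20 h hd hWd)

/-- **Row C16: `E` and every twist `E^{(d)}` satisfy (Im) at `3` together** — the pair of image
hypotheses Yan–Zhu's proof uses for `(E, E^K)`, on every class of D3, granted Wuthrich 2014
Lemma 20. [cite: Wuthrich2014, Lemma 20 (p. 399)] -/
theorem RowC16.bigIm_and_bigIm_twist
    (hW20 : Wuthrich2014.lemma20_surjective_threeAdic_of_semistable) (h : RowC16 W p) {d : ℚ}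
    (hd : d ≠ 0) {Wd : WeierstrassCurve ℚ} [Wd.IsElliptic]
    (hWd : ∃ C : VariableChange ℚ, C • W.quadraticTwist d = Wd) : BigIm W p ∧ BigIm Wd 3 :=
  ⟨RowC16.bigIm hW20 h, RowC16.bigIm_twist hW20 h hd hWd⟩

end RowC16

end Summit.BirchSwinnertonDyer.Rank1Residual

end
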